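import Summits.CriticalPhenomena.PercolationContinuityZ3.Theorems.PercNearOneGluingNoHeavyLowerTailTwoCopyFibre

/-!
# Crux `NoHeavyLowerTail` (stmt-CriticalPhenomena-4575): THREE-copy (profile / fibre) decomposition of cubic rows

Measure-free bookkeeping companion of `…TwoCopyFibre` (two copies, bidegree-2 certificates), for CUBIC
functionals of a law, i.e. expectations over THREE independent copies of a product measure on `m` coordinates
(configurations are bit masks `c < 2^m`; `wt_w(c) = Π_i (w_i if bit i of c else 1 − w_i)`).

For a function `G(c₁,c₂,c₃)` of a triple of configurations put `Φ₃(w) := Σ_{c₁,c₂,c₃} G(c₁,c₂,c₃) wt(c₁)wt(c₂)wt(c₃)`.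
Grouping the triples by their PROFILE (fibre key) `(S₃,S₂,S₁)` = (coordinates open in all three copies, in exactly
two, in exactly one), the weight `wt(c₁)wt(c₂)wt(c₃)` is the fibre monomial
`Π_{S₃} w_i³ · Π_{S₂} w_i²(1−w_i) · Π_{S₁} w_i(1−w_i)² · Π_{rest} (1−w_i)³` (`wt_mul3`), nonnegative on the cube, so
`Φ₃(w) ≥ 0` on `[0,1]^m` as soon as every FIBRE SUM `Σ_{key = (S₃,S₂,S₁)} G` is nonnegative
(`threeCopy_nonneg_of_fibres`).  Specialised to `G(c₁,c₂,c₃) = κ(λ c₁, λ c₂, λ c₃)` for a labeling `λ` of the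
configurations by labels `< L` and an integer kernel `κ`, `Φ₃` is the cubic form `Σ κ(l₁,l₂,l₃) m_{l₁} m_{l₂} m_{l₃}`
in the label masses `m_l = E_w[1_{λ = l}]` (`cubicForm_eq_Phi3`); with the kernel `hqtKernel` of
`H_{q+t} = (a+b)(ab − e₂(c)) − e₃(c)` (labels `B=0, C₁=1, C₂=2, C₃=3, A=4`; `a = m_4`, `b = m_0`, `c_i = m_i`) this gives:
if every fibre sum of `hqtKernel ∘ λ` is ≥ 0 then `H_{q+t}(m(w)) ≥ 0` for every `w ∈ [0,1]^m` (`hqt_nonneg_of_fibres`).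
This is the formal half of the route 'fibre positivity M(HQT) ⟹ H_{q+t} ⟹ AG⁺ ⟹ SHK3⁺ on every product measure'
(new-inequality factory seat prim-ineq-gen-5, gen 4; the fibre sums are integers and were checked ≥ 0 for all
sunflower labelings of `{0,1}^m`, `m ≤ 4`).  Nothing here asserts fibre positivity; it is the hypothesis.
-/

namespace Summit.CriticalPhenomena.PercolationContinuityZ3.Theorems.ThreeCopy

open Finset
open Summit.CriticalPhenomena.PercolationContinuityZ3.Theorems.TwoCopy (wt ex wt_nonneg and_lt_two_pow
  xor_lt_two_pow or_lt_two_pow)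

/-! ## The three-copy fibre monomial -/

/-- Fibre monomial of the profile `(S₃,S₂,S₁)`: `Π_{S₃} w³ Π_{S₂} w²(1−w) Π_{S₁} w(1−w)² Π_{rest} (1−w)³`. [this work] -/
def mono3 (m : ℕ) (w : ℕ → ℝ) (S3 S2 S1 : ℕ) : ℝ :=
  ∏ i ∈ range m,
    if S3.testBit i then w i * w i * w i
    else if S2.testBit i then w i * w i * (1 - w i)
    else if S1.testBit i then w i * (1 - w i) * (1 - w i)
    else (1 - w i) * (1 - w i) * (1 - w i)

/-- Fibre monomials are nonnegative on the cube. [this work] -/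
theorem mono3_nonneg (m : ℕ) {w : ℕ → ℝ} (hw : ∀ i, 0 ≤ w i ∧ w i ≤ 1) (S3 S2 S1 : ℕ) :
    0 ≤ mono3 m w S3 S2 S1 := by
  unfold mono3
  refine prod_nonneg fun i _ => ?_
  have h0 := (hw i).1; have h1 : 0 ≤ 1 - w i := sub_nonneg.2 (hw i).2
  split_ifs <;> positivity

/-- Coordinates open in all three copies. [this work] -/
def all3 (c1 c2 c3 : ℕ) : ℕ := c1 &&& c2 &&& c3

/-- Coordinates open in exactly two copies. [this work] -/
def two3 (c1 c2 c3 : ℕ) : ℕ := ((c1 &&& c2) ||| (c1 &&& c3) ||| (c2 &&& c3)) ^^^ all3 c1 c2 c3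

/-- Coordinates open in exactly one copy. [this work] -/
def one3 (c1 c2 c3 : ℕ) : ℕ := (c1 ^^^ c2 ^^^ c3) ^^^ all3 c1 c2 c3

/-- The profile (fibre key) of a triple of configurations. [this work] -/
def key3 (x : ℕ × ℕ × ℕ) : ℕ × ℕ × ℕ := (all3 x.1 x.2.1 x.2.2, two3 x.1 x.2.1 x.2.2, one3 x.1 x.2.1 x.2.2)

/-- The product of three weights is the fibre monomial of the profile. [this work] -/
theorem wt_mul3 (m : ℕ) (w : ℕ → ℝ) (c1 c2 c3 : ℕ) :
    wt m w c1 * wt m w c2 * wt m w c3 = mono3 m w (all3 c1 c2 c3) (two3 c1 c2 c3) (one3 c1 c2 c3) := by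
  simp only [wt, mono3, two3, one3, all3]
  rw [← prod_mul_distrib, ← prod_mul_distrib]
  refine prod_congr rfl fun i _ => ?_
  simp only [Nat.testBit_and, Nat.testBit_xor, Nat.testBit_or]
  cases c1.testBit i <;> cases c2.testBit i <;> cases c3.testBit i <;>
    simp only [Bool.and_true, Bool.and_false, Bool.or_true, Bool.or_false, Bool.xor_true, Bool.xor_false,
      Bool.not_true, Bool.not_false, Bool.false_eq_true, if_true, if_false] <;> ring

/-! ## The three-copy functional and its fibre sums -/

/-- The index set of triples of configurations on `m` coordinates. [this work] -/
def triples (m : ℕ) : Finset (ℕ × ℕ × ℕ) := range (2 ^ m) ×ˢ (range (2 ^ m) ×ˢ range (2 ^ m))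

/-- `Φ₃(w) = Σ_{c₁,c₂,c₃ < 2^m} G(c₁,c₂,c₃) wt(c₁) wt(c₂) wt(c₃)`. [this work] -/
noncomputable def Phi3 (m : ℕ) (G : ℕ → ℕ → ℕ → ℝ) (w : ℕ → ℝ) : ℝ :=
  ∑ x ∈ triples m, G x.1 x.2.1 x.2.2 * (wt m w x.1 * wt m w x.2.1 * wt m w x.2.2)

/-- The fibre sum of `G` over the profile `k = (S₃,S₂,S₁)`. [this work] -/
def fibsum {α : Type*} [AddCommMonoid α] (m : ℕ) (G : ℕ → ℕ → ℕ → α) (k : ℕ × ℕ × ℕ) : α :=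
  ∑ x ∈ (triples m).filter (fun x => key3 x = k), G x.1 x.2.1 x.2.2

/-- Profiles of triples below `2^m` are below `2^m`. [this work] -/
theorem key3_mem_triples {m : ℕ} {x : ℕ × ℕ × ℕ} (hx : x ∈ triples m) : key3 x ∈ triples m := by
  simp only [triples, mem_product, mem_range] at hx ⊢
  obtain ⟨h1, h2, h3⟩ := hx
  have hA : all3 x.1 x.2.1 x.2.2 < 2 ^ m := and_lt_two_pow (and_lt_two_pow h1)
  refine ⟨hA, ?_, ?_⟩
  · exact xor_lt_two_pow (or_lt_two_pow (or_lt_two_pow (and_lt_two_pow h1) (and_lt_two_pow h1))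
      (and_lt_two_pow h2)) hA
  · exact xor_lt_two_pow (xor_lt_two_pow (xor_lt_two_pow h1 h2) h3) hA

/-- Regrouping by fibres: `Φ₃(w) = Σ_k mono3_k(w) · (fibre sum of G over k)`. [this work] -/
theorem Phi3_eq_sum_fibres (m : ℕ) (G : ℕ → ℕ → ℕ → ℝ) (w : ℕ → ℝ) :
    Phi3 m G w = ∑ k ∈ triples m, mono3 m w k.1 k.2.1 k.2.2 * fibsum m G k := by
  have hmaps : ∀ x ∈ triples m, key3 x ∈ triples m := fun x hx => key3_mem_triples hx
  unfold Phi3 fibsum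
  rw [show (∑ x ∈ triples m, G x.1 x.2.1 x.2.2 * (wt m w x.1 * wt m w x.2.1 * wt m w x.2.2)) =
      ∑ k ∈ triples m, ∑ x ∈ (triples m).filter (fun x => key3 x = k),
        G x.1 x.2.1 x.2.2 * (wt m w x.1 * wt m w x.2.1 * wt m w x.2.2) from
    (sum_fiberwise_of_maps_to hmaps _).symm]
  refine sum_congr rfl fun k _ => ?_
  rw [mul_sum]
  refine sum_congr rfl fun x hx => ?_
  rw [← (mem_filter.1 hx).2]
  unfold key3
  rw [wt_mul3]
  ring

/-- **Soundness of the three-copy fibre method.** If every fibre sum of `G` is nonnegative, then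
`Φ₃(w) ≥ 0` for all `w ∈ [0,1]^m`. [this work] -/
theorem threeCopy_nonneg_of_fibres {m : ℕ} {G : ℕ → ℕ → ℕ → ℝ}
    (hfib : ∀ k ∈ triples m, 0 ≤ fibsum m G k) {w : ℕ → ℝ} (hw : ∀ i, 0 ≤ w i ∧ w i ≤ 1) :
    0 ≤ Phi3 m G w := by
  rw [Phi3_eq_sum_fibres]
  exact sum_nonneg fun k hk => mul_nonneg (mono3_nonneg m hw _ _ _) (hfib k hk)

/-! ## Cubic forms in label masses -/

/-- Mass of the label `l` under the labeling `lab`: `m_l(w) = E_w[1_{lab = l}]`. [this work] -/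
noncomputable def mass (m : ℕ) (w : ℕ → ℝ) (lab : ℕ → ℕ) (l : ℕ) : ℝ :=
  ex m w (fun c => if lab c = l then 1 else 0)

/-- The index set of label triples below `L`. [this work] -/
def labTriples (L : ℕ) : Finset (ℕ × ℕ × ℕ) := range L ×ˢ (range L ×ˢ range L)

/-- The cubic form `Σ_{l₁,l₂,l₃ < L} κ(l₁,l₂,l₃) m_{l₁} m_{l₂} m_{l₃}` of an integer kernel in the label masses. [this work] -/
noncomputable def cubicForm (m L : ℕ) (κ : ℕ → ℕ → ℕ → ℤ) (w : ℕ → ℝ) (lab : ℕ → ℕ) : ℝ :=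
  ∑ lt ∈ labTriples L, (κ lt.1 lt.2.1 lt.2.2 : ℝ) * (mass m w lab lt.1 * mass m w lab lt.2.1 * mass m w lab lt.2.2)

/-- The pulled-back kernel `G(c₁,c₂,c₃) = κ(lab c₁, lab c₂, lab c₃)`. [this work] -/
def labKernel (κ : ℕ → ℕ → ℕ → ℤ) (lab : ℕ → ℕ) (c1 c2 c3 : ℕ) : ℤ := κ (lab c1) (lab c2) (lab c3)

/-- A product of three expectations is a sum over triples of configurations. [this work] -/
theorem ex_mul3 (m : ℕ) (w : ℕ → ℝ) (f1 f2 f3 : ℕ → ℝ) :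
    ex m w f1 * ex m w f2 * ex m w f3 =
      ∑ x ∈ triples m, (f1 x.1 * f2 x.2.1 * f3 x.2.2) * (wt m w x.1 * wt m w x.2.1 * wt m w x.2.2) := by
  unfold ex triples
  simp only [Finset.sum_product]
  rw [Finset.sum_mul_sum, Finset.sum_mul]
  refine sum_congr rfl fun c1 _ => ?_
  rw [Finset.sum_mul]
  refine sum_congr rfl fun c2 _ => ?_
  rw [Finset.mul_sum]
  exact sum_congr rfl fun c3 _ => by ring

/-- The cubic form in the label masses is the three-copy functional of the pulled-back kernel
(labels are assumed to lie below `L`). [this work] -/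
theorem cubicForm_eq_Phi3 (m L : ℕ) (κ : ℕ → ℕ → ℕ → ℤ) (w : ℕ → ℝ) (lab : ℕ → ℕ)
    (hlab : ∀ c, lab c < L) :
    cubicForm m L κ w lab = Phi3 m (fun c1 c2 c3 => (labKernel κ lab c1 c2 c3 : ℝ)) w := by
  unfold cubicForm mass Phi3
  simp only [ex_mul3, mul_sum]
  rw [sum_comm]
  refine sum_congr rfl fun x _ => ?_
  -- collapse the sum over label triples
  have hind : ∀ lt : ℕ × ℕ × ℕ,
      (κ lt.1 lt.2.1 lt.2.2 : ℝ) *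
          ((if lab x.1 = lt.1 then (1:ℝ) else 0) * (if lab x.2.1 = lt.2.1 then (1:ℝ) else 0) *
              (if lab x.2.2 = lt.2.2 then (1:ℝ) else 0) * (wt m w x.1 * wt m w x.2.1 * wt m w x.2.2)) =
        if (lab x.1, lab x.2.1, lab x.2.2) = lt then
          (κ lt.1 lt.2.1 lt.2.2 : ℝ) * (wt m w x.1 * wt m w x.2.1 * wt m w x.2.2) else 0 := by
    intro lt
    obtain ⟨l1, l2, l3⟩ := lt
    by_cases h1 : lab x.1 = l1 <;> by_cases h2 : lab x.2.1 = l2 <;> by_cases h3 : lab x.2.2 = l3 <;>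
      simp [h1, h2, h3]
  rw [sum_congr rfl fun lt _ => hind lt, sum_ite_eq]
  have hmem : (lab x.1, lab x.2.1, lab x.2.2) ∈ labTriples L := by
    simp only [labTriples, mem_product, mem_range]
    exact ⟨hlab _, hlab _, hlab _⟩
  rw [if_pos hmem]
  rfl

/-- **Fibre positivity implies positivity of the cubic form** on the whole cube of coordinate probabilities. [this work] -/
theorem cubicForm_nonneg_of_fibres {m L : ℕ} {κ : ℕ → ℕ → ℕ → ℤ} {lab : ℕ → ℕ} (hlab : ∀ c, lab c < L)
    (hfib : ∀ k ∈ triples m, 0 ≤ fibsum m (labKernel κ lab) k) {w : ℕ → ℝ} (hw : ∀ i, 0 ≤ w i ∧ w i ≤ 1) :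
    0 ≤ cubicForm m L κ w lab := by
  rw [cubicForm_eq_Phi3 m L κ w lab hlab]
  refine threeCopy_nonneg_of_fibres (fun k hk => ?_) hw
  have hcast : ((fibsum m (labKernel κ lab) k : ℤ) : ℝ) =
      fibsum m (fun c1 c2 c3 => (labKernel κ lab c1 c2 c3 : ℝ)) k := by
    unfold fibsum; push_cast; rfl
  rw [← hcast]
  exact_mod_cast hfib k hk

/-! ## The kernel of `H_{q+t}` -/

/-- Label codes: `B = 0` (outside), petals `C₁ = 1, C₂ = 2, C₃ = 3`, core `A = 4`. Petal test. [this work] -/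
def isPetal (l : ℕ) : Bool := decide (1 ≤ l ∧ l ≤ 3)

/-- The symmetric integer kernel (six times the trilinear form) of `H_{q+t} = (a+b)(ab − e₂(c)) − e₃(c)`:
ordered patterns `{A,A,B}` and `{A,B,B}` get `+2`; `{A or B, Cᵢ, Cⱼ}` with `i ≠ j` and `{C₁,C₂,C₃}` get `−1`;
everything else `0`. [this work] -/
def hqtKernel (l1 l2 l3 : ℕ) : ℤ :=
  let nA := (if l1 = 4 then 1 else 0) + (if l2 = 4 then 1 else 0) + (if l3 = 4 then 1 else 0)
  let nB := (if l1 = 0 then 1 else 0) + (if l2 = 0 then 1 else 0) + (if l3 = 0 then 1 else 0)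
  let nP := (if isPetal l1 then 1 else 0) + (if isPetal l2 then 1 else 0) + (if isPetal l3 then 1 else 0)
  let distinctPetals : Bool :=
    (!(isPetal l1 && isPetal l2 && decide (l1 = l2))) && (!(isPetal l1 && isPetal l3 && decide (l1 = l3))) &&
      (!(isPetal l2 && isPetal l3 && decide (l2 = l3)))
  if nA = 2 ∧ nB = 1 then 2
  else if nA = 1 ∧ nB = 2 then 2
  else if nA + nB = 1 ∧ nP = 2 ∧ distinctPetals then -1
  else if nP = 3 ∧ distinctPetals then -1
  else 0

/-- `H_{q+t}` as a polynomial in the five masses `(b, c₁, c₂, c₃, a)`. [this work] -/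
def hqt (b c1 c2 c3 a : ℝ) : ℝ := (a + b) * (a * b - (c1 * c2 + c1 * c3 + c2 * c3)) - c1 * c2 * c3

/-- The cubic form of `hqtKernel` is six times `H_{q+t}` of the masses. [this work] -/
theorem cubicForm_hqtKernel (m : ℕ) (w : ℕ → ℝ) (lab : ℕ → ℕ) :
    cubicForm m 5 hqtKernel w lab =
      6 * hqt (mass m w lab 0) (mass m w lab 1) (mass m w lab 2) (mass m w lab 3) (mass m w lab 4) := by
  unfold cubicForm labTriples hqt
  simp only [sum_product, sum_range_succ, sum_range_zero, zero_add]
  norm_num [hqtKernel, isPetal]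
  ring

/-- **`H_{q+t}` from fibre positivity.**  If `lab` labels the configurations on `m` coordinates by
`{0,…,4}` (read `0 = B`, `1,2,3 =` petals, `4 = A`) and every three-copy fibre sum of `hqtKernel ∘ lab` is
nonnegative, then `H_{q+t} = (a+b)(ab − e₂(c)) − e₃(c) ≥ 0` for the label masses under every `w ∈ [0,1]^m`. [this work] -/
theorem hqt_nonneg_of_fibres {m : ℕ} {lab : ℕ → ℕ} (hlab : ∀ c, lab c < 5)
    (hfib : ∀ k ∈ triples m, 0 ≤ fibsum m (labKernel hqtKernel lab) k)
    {w : ℕ → ℝ} (hw : ∀ i, 0 ≤ w i ∧ w i ≤ 1) :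
    0 ≤ hqt (mass m w lab 0) (mass m w lab 1) (mass m w lab 2) (mass m w lab 3) (mass m w lab 4) := by
  have h := cubicForm_nonneg_of_fibres hlab hfib hw
  rw [cubicForm_hqtKernel] at h
  linarith

/-! ## The kernel of Richards' / Sahi's `E₃` (three arbitrary events) -/

/-- Membership bits of a label `l < 8`: bit 0 (`l % 2`) = `U`, bit 1 = `V`, bit 2 = `W`. [this work] -/
def inU (l : ℕ) : Bool := decide (l % 2 = 1)
/-- See `inU`. [this work] -/
def inV (l : ℕ) : Bool := decide (l / 2 % 2 = 1)
/-- See `inU`. [this work] -/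
def inW (l : ℕ) : Bool := decide (l / 4 % 2 = 1)

/-- The three-copy integer kernel of Sahi's `E₃` (Richards' inequality): with `N_U` = number of the three
labels lying in `U` etc., `Z = N_U N_V N_W + 9 N_{UVW} − 2 (N_U N_{VW} + N_V N_{UW} + N_W N_{UV})`;
`E[Z] = 6·E₃` over three independent copies (prim-ineq-gen-8's 'Richards-comb' kernel). [this work] -/
def richardsKernel (l1 l2 l3 : ℕ) : ℤ :=
  let b : Bool → ℤ := fun x => if x then 1 else 0
  let nU := b (inU l1) + b (inU l2) + b (inU l3)
  let nV := b (inV l1) + b (inV l2) + b (inV l3)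
  let nW := b (inW l1) + b (inW l2) + b (inW l3)
  let nUVW := b (inU l1 && inV l1 && inW l1) + b (inU l2 && inV l2 && inW l2) + b (inU l3 && inV l3 && inW l3)
  let nVW := b (inV l1 && inW l1) + b (inV l2 && inW l2) + b (inV l3 && inW l3)
  let nUW := b (inU l1 && inW l1) + b (inU l2 && inW l2) + b (inU l3 && inW l3)
  let nUV := b (inU l1 && inV l1) + b (inU l2 && inV l2) + b (inU l3 && inV l3)
  nU * nV * nW + 9 * nUVW - 2 * (nU * nVW + nV * nUW + nW * nUV)

/-- Sahi's `E₃` functional, homogenised with the total mass `σ`, as a polynomial in the eight atom masses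
`m_l`, `l < 8` (bit 0/1/2 of `l` = membership in `U`/`V`/`W`):
`E₃ = 2 μ(UVW) σ² + μ(U)μ(V)μ(W) − σ (μ(U)μ(VW) + μ(V)μ(UW) + μ(W)μ(UV))`. [this work] -/
def e3h (x : ℕ → ℝ) : ℝ :=
  let σ := x 0 + x 1 + x 2 + x 3 + x 4 + x 5 + x 6 + x 7
  let u := x 1 + x 3 + x 5 + x 7
  let v := x 2 + x 3 + x 6 + x 7
  let w' := x 4 + x 5 + x 6 + x 7
  let uv := x 3 + x 7
  let uw := x 5 + x 7
  let vw := x 6 + x 7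
  let uvw := x 7
  2 * uvw * σ * σ + u * v * w' - σ * (u * vw + v * uw + w' * uv)

/-- The cubic form of `richardsKernel` is six times the homogenised `E₃` of the atom masses. [this work] -/
theorem cubicForm_richardsKernel (m : ℕ) (w : ℕ → ℝ) (lab : ℕ → ℕ) :
    cubicForm m 8 richardsKernel w lab = 6 * e3h (mass m w lab) := by
  unfold cubicForm labTriples
  rw [sum_product]
  simp only [sum_range_succ, sum_range_zero, zero_add, sum_product]
  norm_num [richardsKernel, inU, inV, inW, e3h]
  ring

/-- **Richards / Sahi `E₃` from fibre positivity ('Richards-comb').**  If `lab` labels the configurations on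
`m` coordinates by `{0,…,7}` (membership pattern in three events `U,V,W`) and every three-copy fibre sum of
`richardsKernel ∘ lab` is nonnegative, then the homogenised `E₃` of the atom masses is `≥ 0` for every
`w ∈ [0,1]^m` (for probability weights `σ = 1` and this is `2μ(UVW) + μ(U)μ(V)μ(W) − Σ μ(U)μ(VW) ≥ 0`). [this work] -/
theorem e3_nonneg_of_fibres {m : ℕ} {lab : ℕ → ℕ} (hlab : ∀ c, lab c < 8)
    (hfib : ∀ k ∈ triples m, 0 ≤ fibsum m (labKernel richardsKernel lab) k)
    {w : ℕ → ℝ} (hw : ∀ i, 0 ≤ w i ∧ w i ≤ 1) :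
    0 ≤ e3h (mass m w lab) := by
  have h := cubicForm_nonneg_of_fibres hlab hfib hw
  rw [cubicForm_richardsKernel] at h
  linarith

end Summit.CriticalPhenomena.PercolationContinuityZ3.Theorems.ThreeCopy
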